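import Mathlib

/-!
# Pairwise-compatible two-coin petals merge favourably (every number of petals)

Two-coin systems (prove-1 gen 55, THEOREM Y).  Weights `ε₁, ε₂ ≥ 0` with `ε₁ + ε₂ ≤ 1` (a sub-probability two-point space;
the missing mass `c = 1 − ε₁ − ε₂` is the constant atom), petals `j` with nonnegative usages `A_j` (coin 1) and `B_j` (coin 2)
and value `ε₁ A_j + ε₂ B_j` (the constant atom contributes `0`: we work with EXCESS values).  The two-coin merge defect of a
pair is `(ε₁A_i + ε₂B_i)(ε₁A_j + ε₂B_j) − (ε₁A_iA_j + ε₂B_iB_j)`; a pair is COMPATIBLE if this is `≤ 0`.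

**`two_coin_pairwise_prod_le` (THEOREM Y).**  If every pair of distinct petals of a nonempty family is compatible, then the whole
family merges favourably: `∏_j (ε₁A_j + ε₂B_j) ≤ ε₁ ∏_j A_j + ε₂ ∏_j B_j`.

Proof: induction on the number of petals, merging two petals `u, v` into `(A_uA_v, B_uB_v)` (which costs exactly the pair
defect of `u, v`) and checking that the merged family is again pairwise compatible: petals on the same side of the diagonal
`A = B` are always compatible (`same_side_compat`, Chebyshev), and if `B_u ≥ A_u`, `A_v ≥ B_v` the merged petal inherits every
compatibility of `u` and `v` (`merge_compat`: a third petal `Q` rejects small `A/B` ratios or small `B/A` ratios, never both).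
In the sunflower model (coins Ȳ-face and H-face, excesses `a_j = ε_Y(x_j−1)`, `b_j = ε_H(y^H_j−1)`) this gives
`∏ V_j ≤ c + ε_Y X + ε_H Y` and hence (RES0′) for every `n` from the two FACE budgets for all pairwise-compatible families —
in particular for every family without a Ȳ-heavy petal (`res0_pairwise`, separate file). [this work]
-/

namespace Summit.CriticalPhenomena.PercolationContinuityZ3.Theorems.SunflowerPartition.SafeCalc.LinkedCurrency

open Finset

section TwoCoin

variable {ε₁ ε₂ : ℝ}

/-- The compatibility form `H(P,Q) = ε₁A_PA_Q + ε₂B_PB_Q − (ε₁A_P+ε₂B_P)(ε₁A_Q+ε₂B_Q)` splits as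
`ε₁A_P·s(Q) + ε₂B_P·s'(Q)` with `s(Q) = (1−ε₁)A_Q − ε₂B_Q`, `s'(Q) = (1−ε₂)B_Q − ε₁A_Q`. [this work] -/
theorem twoCoin_split (A B A' B' : ℝ) :
    ε₁ * (A * A') + ε₂ * (B * B') - (ε₁ * A + ε₂ * B) * (ε₁ * A' + ε₂ * B') =
      ε₁ * A * ((1 - ε₁) * A' - ε₂ * B') + ε₂ * B * ((1 - ε₂) * B' - ε₁ * A') := by ring

/-- The two type-functionals `s, s'` of a petal with nonnegative usages are never both negative
(`(1−ε₁)(1−ε₂) ≥ ε₁ε₂` because `ε₁ + ε₂ ≤ 1`). [this work] -/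
theorem twoCoin_not_both_neg (h1 : 0 ≤ ε₁) (h2 : 0 ≤ ε₂) (h12 : ε₁ + ε₂ ≤ 1) {A B : ℝ} (hA : 0 ≤ A) (hB : 0 ≤ B)
    (hs : (1 - ε₁) * A - ε₂ * B < 0) : 0 ≤ (1 - ε₂) * B - ε₁ * A := by
  by_contra hs'
  push Not at hs'
  -- (1-ε₁)A < ε₂B and (1-ε₂)B < ε₁A ⇒ (1-ε₁)(1-ε₂)AB < ε₁ε₂AB, contradiction
  have hB0 : 0 < B := by
    rcases eq_or_lt_of_le hB with h | h
    · rw [← h] at hs; nlinarith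
    · exact h
  have hA0 : 0 < A := by
    rcases eq_or_lt_of_le hA with h | h
    · rw [← h] at hs'; nlinarith
    · exact h
  have e1 : (1 - ε₁) * A < ε₂ * B := by linarith
  have e2 : (1 - ε₂) * B < ε₁ * A := by linarith
  have hε2 : 0 < ε₂ := by
    by_contra h; push Not at h
    have : ε₂ = 0 := le_antisymm h h2
    rw [this] at e1; nlinarith
  have hε1 : 0 < ε₁ := by
    by_contra h; push Not at h
    have : ε₁ = 0 := le_antisymm h h1
    rw [this] at e2; nlinarith
  have h3 : (1 - ε₁) * A * ((1 - ε₂) * B) < ε₂ * B * (ε₁ * A) := by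
    have := mul_lt_mul e1 e2.le (mul_pos (by linarith) hB0) (mul_nonneg hε2.le hB)
    linarith
  have h4 : 0 ≤ ((1 - ε₁) * (1 - ε₂) - ε₁ * ε₂) * (A * B) :=
    mul_nonneg (by nlinarith) (mul_nonneg hA hB)
  nlinarith

/-- **Same side of the diagonal ⇒ compatible** (Chebyshev on the three-atom space): if `(A−B)(A'−B') ≥ 0` then
`(ε₁A+ε₂B)(ε₁A'+ε₂B') ≤ ε₁AA' + ε₂BB'`. [this work] -/
theorem same_side_compat (h1 : 0 ≤ ε₁) (h2 : 0 ≤ ε₂) (h12 : ε₁ + ε₂ ≤ 1) {A B A' B' : ℝ} (hA : 0 ≤ A) (hB : 0 ≤ B)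
    (hA' : 0 ≤ A') (hB' : 0 ≤ B') (hside : 0 ≤ (A - B) * (A' - B')) :
    (ε₁ * A + ε₂ * B) * (ε₁ * A' + ε₂ * B') ≤ ε₁ * (A * A') + ε₂ * (B * B') := by
  -- H = ε₁(1−ε₁)AA' − ε₁ε₂(AB'+BA') + ε₂(1−ε₂)BB' ≥ ε₁ε₂ (A−B)(A'−B')
  have t1 : ε₁ * ε₂ * (A * A') ≤ ε₁ * (1 - ε₁) * (A * A') :=
    mul_le_mul_of_nonneg_right (mul_le_mul_of_nonneg_left (by linarith) h1) (mul_nonneg hA hA')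
  have t2 : ε₁ * ε₂ * (B * B') ≤ ε₂ * (1 - ε₂) * (B * B') := by
    have := mul_le_mul_of_nonneg_right (mul_le_mul_of_nonneg_left (show ε₁ ≤ 1 - ε₂ by linarith) h2) (mul_nonneg hB hB')
    linarith
  nlinarith [mul_nonneg (mul_nonneg h1 h2) hside]

/-- **Merge lemma.**  If `u = (A_u,B_u)` lies on or below the diagonal (`A_u ≤ B_u`) and `v` on or above it (`B_v ≤ A_v`), then
the merged petal `(A_uA_v, B_uB_v)` is compatible with every petal `Q` compatible with both `u` and `v`. [this work] -/
theorem merge_compat (h1 : 0 ≤ ε₁) (h2 : 0 ≤ ε₂) (h12 : ε₁ + ε₂ ≤ 1) {Au Bu Av Bv A B : ℝ} (hAu : 0 ≤ Au) (hBu : 0 ≤ Bu)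
    (hAv : 0 ≤ Av) (hBv : 0 ≤ Bv) (hA : 0 ≤ A) (hB : 0 ≤ B) (hu : Au ≤ Bu) (hv : Bv ≤ Av)
    (hcu : (ε₁ * Au + ε₂ * Bu) * (ε₁ * A + ε₂ * B) ≤ ε₁ * (Au * A) + ε₂ * (Bu * B))
    (hcv : (ε₁ * Av + ε₂ * Bv) * (ε₁ * A + ε₂ * B) ≤ ε₁ * (Av * A) + ε₂ * (Bv * B)) :
    (ε₁ * (Au * Av) + ε₂ * (Bu * Bv)) * (ε₁ * A + ε₂ * B) ≤ ε₁ * (Au * Av * A) + ε₂ * (Bu * Bv * B) := by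
  -- write everything through the split H(P,Q) = ε₁A_P s + ε₂B_P s'
  obtain ⟨s, hs⟩ : ∃ s, s = (1 - ε₁) * A - ε₂ * B := ⟨_, rfl⟩
  obtain ⟨s', hs'⟩ : ∃ t, t = (1 - ε₂) * B - ε₁ * A := ⟨_, rfl⟩
  have eu : ε₁ * (Au * A) + ε₂ * (Bu * B) - (ε₁ * Au + ε₂ * Bu) * (ε₁ * A + ε₂ * B) = ε₁ * Au * s + ε₂ * Bu * s' := by
    rw [hs, hs']; ring
  have ev : ε₁ * (Av * A) + ε₂ * (Bv * B) - (ε₁ * Av + ε₂ * Bv) * (ε₁ * A + ε₂ * B) = ε₁ * Av * s + ε₂ * Bv * s' := by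
    rw [hs, hs']; ring
  have eM : ε₁ * (Au * Av * A) + ε₂ * (Bu * Bv * B) - (ε₁ * (Au * Av) + ε₂ * (Bu * Bv)) * (ε₁ * A + ε₂ * B) =
      ε₁ * (Au * Av) * s + ε₂ * (Bu * Bv) * s' := by
    rw [hs, hs']; ring
  have Hu : 0 ≤ ε₁ * Au * s + ε₂ * Bu * s' := by rw [← eu]; linarith
  have Hv : 0 ≤ ε₁ * Av * s + ε₂ * Bv * s' := by rw [← ev]; linarith
  suffices hM : 0 ≤ ε₁ * (Au * Av) * s + ε₂ * (Bu * Bv) * s' by rw [← eM] at hM; linarith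
  rcases le_or_gt 0 s with hs0 | hs0 <;> rcases le_or_gt 0 s' with hs0' | hs0'
  · -- middle type: both functionals nonnegative
    exact add_nonneg (mul_nonneg (mul_nonneg h1 (mul_nonneg hAu hAv)) hs0) (mul_nonneg (mul_nonneg h2 (mul_nonneg hBu hBv)) hs0')
  · -- s ≥ 0 > s': Q rejects small A/B; use u's compatibility and A_v ≥ B_v
    -- ε₁ Au Av s ≥ Av · ε₂ Bu (−s') ≥ Bv · ε₂ Bu (−s')
    have a1 : ε₂ * Bu * (-s') ≤ ε₁ * Au * s := by linarith
    have a2 : Av * (ε₂ * Bu * (-s')) ≤ Av * (ε₁ * Au * s) := mul_le_mul_of_nonneg_left a1 hAv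
    have a3 : Bv * (ε₂ * Bu * (-s')) ≤ Av * (ε₂ * Bu * (-s')) :=
      mul_le_mul_of_nonneg_right hv (mul_nonneg (mul_nonneg h2 hBu) (by linarith))
    nlinarith
  · -- s < 0 ≤ s': use v's compatibility and B_u ≥ A_u
    have a1 : ε₁ * Av * (-s) ≤ ε₂ * Bv * s' := by linarith
    have a2 : Bu * (ε₁ * Av * (-s)) ≤ Bu * (ε₂ * Bv * s') := mul_le_mul_of_nonneg_left a1 hBu
    have a3 : Au * (ε₁ * Av * (-s)) ≤ Bu * (ε₁ * Av * (-s)) :=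
      mul_le_mul_of_nonneg_right hu (mul_nonneg (mul_nonneg h1 hAv) (by linarith))
    nlinarith
  · -- both negative is impossible
    exact absurd (twoCoin_not_both_neg h1 h2 h12 hA hB (by rw [hs] at hs0; exact hs0)) (by rw [hs'] at hs0'; exact not_le.2 hs0')

/-- **THEOREM Y: pairwise-compatible two-coin petals merge favourably (every number of petals).**  For `ε₁, ε₂ ≥ 0`,
`ε₁ + ε₂ ≤ 1`, a nonempty finite family of petals with usages `A_j, B_j ≥ 0` in which every two distinct petals are compatible,
`∏_j (ε₁A_j + ε₂B_j) ≤ ε₁∏_j A_j + ε₂∏_j B_j`. [this work] -/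
theorem two_coin_pairwise_prod_le {ι : Type*} [DecidableEq ι] (h1 : 0 ≤ ε₁) (h2 : 0 ≤ ε₂) (h12 : ε₁ + ε₂ ≤ 1) :
    ∀ (n : ℕ) (S : Finset ι) (A B : ι → ℝ), S.card = n + 1 → (∀ j ∈ S, 0 ≤ A j) → (∀ j ∈ S, 0 ≤ B j) →
      (∀ i ∈ S, ∀ j ∈ S, i ≠ j → (ε₁ * A i + ε₂ * B i) * (ε₁ * A j + ε₂ * B j) ≤ ε₁ * (A i * A j) + ε₂ * (B i * B j)) →
      ∏ j ∈ S, (ε₁ * A j + ε₂ * B j) ≤ ε₁ * ∏ j ∈ S, A j + ε₂ * ∏ j ∈ S, B j := by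
  intro n
  induction' n with n ih
  · intro S A B hcard _ _ _
    obtain ⟨a, rfl⟩ := Finset.card_eq_one.1 hcard
    simp
  · intro S A B hcard hA hB hcompat
    -- |S| = n + 2 ≥ 2.  Generic merge step: given u ≠ v in S such that the merged family is pairwise compatible.
    have merge : ∀ u ∈ S, ∀ v ∈ S, u ≠ v →
        (∀ q ∈ S, q ≠ u → q ≠ v →
          (ε₁ * (A u * A v) + ε₂ * (B u * B v)) * (ε₁ * A q + ε₂ * B q) ≤ ε₁ * (A u * A v * A q) + ε₂ * (B u * B v * B q)) →
        ∏ j ∈ S, (ε₁ * A j + ε₂ * B j) ≤ ε₁ * ∏ j ∈ S, A j + ε₂ * ∏ j ∈ S, B j := by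
      intro u hu v hv huv hM
      -- merged data on S.erase v, with the merged petal sitting at index u
      set A' : ι → ℝ := Function.update A u (A u * A v) with hA'
      set B' : ι → ℝ := Function.update B u (B u * B v) with hB'
      have hcard' : (S.erase v).card = n + 1 := by rw [Finset.card_erase_of_mem hv, hcard]; rfl
      have huS' : u ∈ S.erase v := Finset.mem_erase.2 ⟨huv, hu⟩
      have hA'n : ∀ j ∈ S.erase v, 0 ≤ A' j := by
        intro j hj; rw [hA']
        rcases eq_or_ne j u with rfl | hne
        · rw [Function.update_self]; exact mul_nonneg (hA _ hu) (hA _ hv)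
        · rw [Function.update_of_ne hne]; exact hA j (Finset.mem_of_mem_erase hj)
      have hB'n : ∀ j ∈ S.erase v, 0 ≤ B' j := by
        intro j hj; rw [hB']
        rcases eq_or_ne j u with rfl | hne
        · rw [Function.update_self]; exact mul_nonneg (hB _ hu) (hB _ hv)
        · rw [Function.update_of_ne hne]; exact hB j (Finset.mem_of_mem_erase hj)
      have hcompat' : ∀ i ∈ S.erase v, ∀ j ∈ S.erase v, i ≠ j →
          (ε₁ * A' i + ε₂ * B' i) * (ε₁ * A' j + ε₂ * B' j) ≤ ε₁ * (A' i * A' j) + ε₂ * (B' i * B' j) := by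
        intro i hi j hj hij
        have hi' := Finset.mem_of_mem_erase hi; have hj' := Finset.mem_of_mem_erase hj
        have hiv : i ≠ v := (Finset.mem_erase.1 hi).1; have hjv : j ≠ v := (Finset.mem_erase.1 hj).1
        rw [hA', hB']
        rcases eq_or_ne i u with rfl | hiu
        · rw [Function.update_self, Function.update_self, Function.update_of_ne hij.symm, Function.update_of_ne hij.symm]
          exact hM j hj' hij.symm hjv
        · rcases eq_or_ne j u with rfl | hju
          · rw [Function.update_self, Function.update_self, Function.update_of_ne hiu, Function.update_of_ne hiu]
            have h := hM i hi' hiu hiv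
            nlinarith [h]
          · rw [Function.update_of_ne hiu, Function.update_of_ne hiu, Function.update_of_ne hju, Function.update_of_ne hju]
            exact hcompat i hi' j hj' hij
      have IH := ih (S.erase v) A' B' hcard' hA'n hB'n hcompat'
      -- translate products over S.erase v with A', B' back to S with A, B
      have pA : ∏ j ∈ S.erase v, A' j = ∏ j ∈ S, A j := by
        rw [← Finset.mul_prod_erase (S.erase v) A' huS', ← Finset.mul_prod_erase S A hv,
          ← Finset.mul_prod_erase (S.erase v) A (Finset.mem_erase.2 ⟨huv, hu⟩)]
        rw [hA', Function.update_self]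
        have : ∏ x ∈ (S.erase v).erase u, Function.update A u (A u * A v) x = ∏ x ∈ (S.erase v).erase u, A x :=
          Finset.prod_congr rfl (fun x hx => by rw [Function.update_of_ne (Finset.mem_erase.1 hx).1])
        rw [this]; ring
      have pB : ∏ j ∈ S.erase v, B' j = ∏ j ∈ S, B j := by
        rw [← Finset.mul_prod_erase (S.erase v) B' huS', ← Finset.mul_prod_erase S B hv,
          ← Finset.mul_prod_erase (S.erase v) B (Finset.mem_erase.2 ⟨huv, hu⟩)]
        rw [hB', Function.update_self]
        have : ∏ x ∈ (S.erase v).erase u, Function.update B u (B u * B v) x = ∏ x ∈ (S.erase v).erase u, B x :=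
          Finset.prod_congr rfl (fun x hx => by rw [Function.update_of_ne (Finset.mem_erase.1 hx).1])
        rw [this]; ring
      have pV : ∏ j ∈ S.erase v, (ε₁ * A' j + ε₂ * B' j) =
          (ε₁ * (A u * A v) + ε₂ * (B u * B v)) * ∏ j ∈ (S.erase v).erase u, (ε₁ * A j + ε₂ * B j) := by
        rw [← Finset.mul_prod_erase (S.erase v) _ huS', hA', hB', Function.update_self, Function.update_self]
        congr 1
        exact Finset.prod_congr rfl (fun x hx => by
          rw [Function.update_of_ne (Finset.mem_erase.1 hx).1, Function.update_of_ne (Finset.mem_erase.1 hx).1])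
      have pS : ∏ j ∈ S, (ε₁ * A j + ε₂ * B j) =
          (ε₁ * A v + ε₂ * B v) * ((ε₁ * A u + ε₂ * B u) * ∏ j ∈ (S.erase v).erase u, (ε₁ * A j + ε₂ * B j)) := by
        rw [← Finset.mul_prod_erase S _ hv, ← Finset.mul_prod_erase (S.erase v) _ (Finset.mem_erase.2 ⟨huv, hu⟩)]
      -- the merge costs exactly the pair defect of (u, v)
      have hrest : 0 ≤ ∏ j ∈ (S.erase v).erase u, (ε₁ * A j + ε₂ * B j) :=
        Finset.prod_nonneg (fun j hj => by
          have hj' := Finset.mem_of_mem_erase (Finset.mem_of_mem_erase hj)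
          exact add_nonneg (mul_nonneg h1 (hA j hj')) (mul_nonneg h2 (hB j hj')))
      have huvc := hcompat u hu v hv huv
      calc ∏ j ∈ S, (ε₁ * A j + ε₂ * B j)
          = ((ε₁ * A u + ε₂ * B u) * (ε₁ * A v + ε₂ * B v)) * ∏ j ∈ (S.erase v).erase u, (ε₁ * A j + ε₂ * B j) := by
            rw [pS]; ring
        _ ≤ (ε₁ * (A u * A v) + ε₂ * (B u * B v)) * ∏ j ∈ (S.erase v).erase u, (ε₁ * A j + ε₂ * B j) :=
            mul_le_mul_of_nonneg_right huvc hrest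
        _ = ∏ j ∈ S.erase v, (ε₁ * A' j + ε₂ * B' j) := pV.symm
        _ ≤ ε₁ * ∏ j ∈ S.erase v, A' j + ε₂ * ∏ j ∈ S.erase v, B' j := IH
        _ = ε₁ * ∏ j ∈ S, A j + ε₂ * ∏ j ∈ S, B j := by rw [pA, pB]
    -- choose the merge pair
    have hcard2 : 1 < S.card := by rw [hcard]; omega
    by_cases hlow : ∃ u ∈ S, A u ≤ B u
    · by_cases hhigh : ∃ v ∈ S, B v ≤ A v ∧ ∀ u ∈ S, A u ≤ B u → u ≠ v
      · -- mixed: merge a low u with a high v ≠ u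
        obtain ⟨u, hu, hul⟩ := hlow
        obtain ⟨v, hv, hvh, hvne⟩ := hhigh
        have huv : u ≠ v := hvne u hu hul
        refine merge u hu v hv huv (fun q hq hqu hqv => ?_)
        exact merge_compat h1 h2 h12 (hA u hu) (hB u hu) (hA v hv) (hB v hv) (hA q hq) (hB q hq) hul hvh
          (hcompat u hu q hq hqu.symm) (hcompat v hv q hq hqv.symm)
      · -- no high petal distinct from every low one: then every petal is (weakly) low, A_j ≤ B_j for all j
        push Not at hhigh
        have hall : ∀ j ∈ S, A j ≤ B j := by
          intro j hj
          by_contra hlt; push Not at hlt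
          obtain ⟨u, hu, hul, huj⟩ := hhigh j hj hlt.le
          -- u is low and u = j, but j is strictly high: contradiction
          rw [huj] at hul; linarith
        -- merge any two; the merged petal is again low, and low–low pairs are compatible
        obtain ⟨u, hu, v, hv, huv⟩ := Finset.one_lt_card.1 hcard2
        refine merge u hu v hv huv (fun q hq hqu hqv => ?_)
        have hMl : A u * A v ≤ B u * B v := mul_le_mul (hall u hu) (hall v hv) (hA v hv) (hB u hu)
        exact same_side_compat h1 h2 h12 (mul_nonneg (hA u hu) (hA v hv)) (mul_nonneg (hB u hu) (hB v hv)) (hA q hq) (hB q hq)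
          (mul_nonneg_of_nonpos_of_nonpos (by linarith) (by linarith [hall q hq]))
    · -- every petal strictly high
      push Not at hlow
      obtain ⟨u, hu, v, hv, huv⟩ := Finset.one_lt_card.1 hcard2
      refine merge u hu v hv huv (fun q hq hqu hqv => ?_)
      have hMh : B u * B v ≤ A u * A v := mul_le_mul (hlow u hu).le (hlow v hv).le (hB v hv) (hA u hu)
      exact same_side_compat h1 h2 h12 (mul_nonneg (hA u hu) (hA v hv)) (mul_nonneg (hB u hu) (hB v hv)) (hA q hq) (hB q hq)
        (mul_nonneg (by linarith) (by linarith [hlow q hq]))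

/-- **THEOREM Y, Finset form.**  Same statement for an arbitrary nonempty finite family. [this work] -/
theorem two_coin_pairwise_prod_le' {ι : Type*} [DecidableEq ι] (h1 : 0 ≤ ε₁) (h2 : 0 ≤ ε₂) (h12 : ε₁ + ε₂ ≤ 1)
    (S : Finset ι) (hS : S.Nonempty) (A B : ι → ℝ) (hA : ∀ j ∈ S, 0 ≤ A j) (hB : ∀ j ∈ S, 0 ≤ B j)
    (hcompat : ∀ i ∈ S, ∀ j ∈ S, i ≠ j →
      (ε₁ * A i + ε₂ * B i) * (ε₁ * A j + ε₂ * B j) ≤ ε₁ * (A i * A j) + ε₂ * (B i * B j)) :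
    ∏ j ∈ S, (ε₁ * A j + ε₂ * B j) ≤ ε₁ * ∏ j ∈ S, A j + ε₂ * ∏ j ∈ S, B j := by
  obtain ⟨n, hn⟩ : ∃ n, S.card = n + 1 := ⟨S.card - 1, by have := Finset.card_pos.2 hS; omega⟩
  exact two_coin_pairwise_prod_le h1 h2 h12 n S A B hn hA hB hcompat

/-- **THEOREM Y for values with a constant atom (every number of petals).**  Two-coin petals with excesses `a_j, b_j ≥ 0`
(value `1 + a_j + b_j`), masses `ε_Y, ε_H > 0` with `ε_Y + ε_H ≤ 1`; if every two distinct petals have nonpositive two-coin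
merge defect, `(a_i+b_i)(a_j+b_j) ≤ a_ia_j/ε_Y + b_ib_j/ε_H`, then
`∏_j (1 + a_j + b_j) ≤ 1 + ε_Y(∏_j(1 + a_j/ε_Y) − 1) + ε_H(∏_j(1 + b_j/ε_H) − 1)`
(the merged two-coin value: actual face usages).  Proof: expand both sides over sub-families (`Finset.prod_one_add`) and
apply `two_coin_pairwise_prod_le` to every nonempty sub-family. [this work] -/
theorem two_coin_pairwise_family_le {ι : Type*} [DecidableEq ι] {εY εH : ℝ} (hY : 0 < εY) (hH : 0 < εH)
    (hsum : εY + εH ≤ 1) (S : Finset ι) (a b : ι → ℝ) (ha : ∀ j ∈ S, 0 ≤ a j) (hb : ∀ j ∈ S, 0 ≤ b j)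
    (hcompat : ∀ i ∈ S, ∀ j ∈ S, i ≠ j → (a i + b i) * (a j + b j) ≤ a i * a j / εY + b i * b j / εH) :
    ∏ j ∈ S, (1 + a j + b j) ≤ 1 + εY * (∏ j ∈ S, (1 + a j / εY) - 1) + εH * (∏ j ∈ S, (1 + b j / εH) - 1) := by
  have eL : ∏ j ∈ S, (1 + a j + b j) = ∑ t ∈ S.powerset, ∏ j ∈ t, (a j + b j) := by
    rw [← Finset.prod_one_add]; exact Finset.prod_congr rfl (fun j _ => by ring)
  have eA : ∏ j ∈ S, (1 + a j / εY) = ∑ t ∈ S.powerset, ∏ j ∈ t, (a j / εY) := Finset.prod_one_add S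
  have eB : ∏ j ∈ S, (1 + b j / εH) = ∑ t ∈ S.powerset, ∏ j ∈ t, (b j / εH) := Finset.prod_one_add S
  -- right side as a sum over the powerset of F'(t) := [t = ∅] + [t ≠ ∅](ε_Y ∏ a/ε_Y + ε_H ∏ b/ε_H)
  have h0 : (∅ : Finset ι) ∈ S.powerset := Finset.empty_mem_powerset S
  set F : Finset ι → ℝ := fun t => εY * ∏ j ∈ t, (a j / εY) + εH * ∏ j ∈ t, (b j / εH) with hF
  have eR : 1 + εY * (∏ j ∈ S, (1 + a j / εY) - 1) + εH * (∏ j ∈ S, (1 + b j / εH) - 1) =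
      (1 - εY - εH) + ∑ t ∈ S.powerset, F t := by
    rw [eA, eB, hF, Finset.sum_add_distrib, ← Finset.mul_sum, ← Finset.mul_sum]; ring
  rw [eL, eR, ← Finset.add_sum_erase _ _ h0, ← Finset.add_sum_erase _ _ h0]
  simp only [Finset.prod_empty, hF, mul_one]
  have key : ∑ t ∈ S.powerset.erase ∅, ∏ j ∈ t, (a j + b j) ≤
      ∑ t ∈ S.powerset.erase ∅, (εY * ∏ j ∈ t, (a j / εY) + εH * ∏ j ∈ t, (b j / εH)) := by
    apply Finset.sum_le_sum
    intro t ht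
    have htS : t ⊆ S := Finset.mem_powerset.1 (Finset.mem_of_mem_erase ht)
    have htne : t.Nonempty := Finset.nonempty_iff_ne_empty.2 (Finset.ne_of_mem_erase ht)
    have h := two_coin_pairwise_prod_le' hY.le hH.le hsum t htne (fun j => a j / εY) (fun j => b j / εH)
      (fun j hj => div_nonneg (ha j (htS hj)) hY.le) (fun j hj => div_nonneg (hb j (htS hj)) hH.le)
      (fun i hi j hj hij => by
        have hc := hcompat i (htS hi) j (htS hj) hij
        have e1 : εY * (a i / εY) + εH * (b i / εH) = a i + b i := by field_simp
        have e2 : εY * (a j / εY) + εH * (b j / εH) = a j + b j := by field_simp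
        have e3 : εY * (a i / εY * (a j / εY)) + εH * (b i / εH * (b j / εH)) = a i * a j / εY + b i * b j / εH := by
          field_simp
        rw [e1, e2, e3]; exact hc)
    have e4 : ∏ j ∈ t, (εY * (a j / εY) + εH * (b j / εH)) = ∏ j ∈ t, (a j + b j) :=
      Finset.prod_congr rfl (fun j _ => by field_simp)
    rw [e4] at h; exact h
  linarith

end TwoCoin

end Summit.CriticalPhenomena.PercolationContinuityZ3.Theorems.SunflowerPartition.SafeCalc.LinkedCurrency
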